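import Summits.CriticalPhenomena.PercolationContinuityZ3.Theorems.FK.Transplant.FreeBoundaryTransplant
import Summits.CriticalPhenomena.PercolationContinuityZ3.Theorems.FK.Transplant.KNFreeCorridorFK
import Summits.CriticalPhenomena.PercolationContinuityZ3.Theorems.FK.Transplant.KNFreeOrigin
import Summits.CriticalPhenomena.PercolationContinuityZ3.Theorems.FK.Transplant.KNFreeBad
import HarnessLib

/-!
# Free-boundary transplant record — re-cut `_r3` (CONDITIONAL; FT-02 re-cut, writer fkt-lead)

builds on p205010 (kernel theorem, internal audit signed; external expert review pending).
**CONDITIONAL on FH (free-box hittability at the same `p`; GRC Conj. (5.103)-calibre via K1) AND on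
TP_FK (Kozma–Nitzan's target Lemma 10 for finite-volume FK laws; a theorem at `q = 1`; no derivation
known for `q > 1`); a typed reduction, not a proof of FK continuity.**

Barrier note cited first (FBN-01): `Literature.Barriers.CriticalPhenomena.SamePFreeBoundaryCriteria`
(theorem `samePFreeBoundaryCriteria`, fact `Bodineau2005_slabThreshold`; cited by name, not imported).
K1 (verbatim): "[C3a ∀ p > p_c(q)] ∧ C3b ⇒ p̂_c(q) = p_c(q) = GRC Conj (5.103) = DT Question 5 (open for q ∈ (1,2))".

This file is the `_r3` RE-CUT = the END STATE of the re-cut ladder (it supersedes `_r1` = `Transplant/FreeBoundaryTransplantR1.lean`, rows 3–4, p247697, and `_r2` = `Transplant/FreeBoundaryTransplantR2.lean`, rows 3–5, p247840, which stay in the tree) of the transplant record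
`ufsc0_of_freeBoundaryHypothesis_r0` (`Transplant/FreeBoundaryTransplant.lean`, p245214 commit 1d8cc3182944):
the following PROVE binders of record are replaced by their ACCEPTED discharge theorems (hypotheses ⊆ {`1 ≤ q`},
BINDER-OWNERS rule 5), by modus ponens — nothing about FH or TP_FK is proved here:
* row 3 `h_elong : KNFreeElongatedHittable d q p` ← `knFreeElongatedHittable_of_one_le hq p` (`Transplant/KNFreeCorridorFK.lean`, p246349 commit 82a54cfa59b1);
* row 4 `h_corr : KNFreeCorridorRestr d q p` ← `knFreeCorridorRestr_of_one_le hq p` (`Transplant/KNFreeCorridorFK.lean`, p246349 commit 82a54cfa59b1);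
* row 5 `h_orig : KNFreeOriginLook d q p` ← `knFreeOriginLook hq p` (`Transplant/KNFreeOrigin.lean`, p247419 commit 7347cdfff8bb);
* row 6 `h_bad : KNFreeBadRestr d q p` ← `knFreeBadRestr hq p` (`Transplant/KNFreeBad.lean`, p247755 commit 064fb5e82927);
Remaining PROVE binders: none — END STATE: the only hypotheses left are the two OPEN binders, i.e. exactly the named open inputs FH and TP_FK (K1: FH at the same `p` for `q > 1` is GRC Conj. (5.103)-calibre; TP_FK is a theorem only at `q = 1`). This theorem is therefore the cell's final CONDITIONAL statement `FH ∧ TP_FK ⇒ UFSC⁰` for `1 ≤ q`, `d ≥ 3`, `p ∈ (0,1)`; its `q = 1` instance with both OPEN binders discharged by theorems is `ufsc0_one_of_theta_pos` (`Transplant/KNFreeRegressionQOneRecord.lean`, p245867). OPEN binders (unchanged, by design): `hFH : FH d q p` (row 1),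
`h_tgt : KNFreeTargetHittable d q p` (row 2 = TP_FK, lead ruling L7). BINDERS OF RECORD after this re-cut:
2 (= 2 OPEN + 0 PROVE). The `_r0` record stays in the tree unchanged (append-only); `transplant/BINDER-OWNERS.md`
re-cut log is the bookkeeping of record.
-/

namespace Summit.CriticalPhenomena.PercolationContinuityZ3.Theorems.FK

open Literature.Probability.Percolation Literature.Probability.LatticeModels
open Literature.Probability.Percolation.GadgetSystem Literature.Probability.Percolation.KozmaNitzan

variable {d : ℕ}

/-- **Transplant record, re-cut `_r3`** (END STATE — CONDITIONAL on FH AND on TP_FK; 2 binders of record =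
2 OPEN + 0 PROVE: the hypotheses are exactly `hFH` and `h_tgt`). Obtained from `ufsc0_of_freeBoundaryHypothesis_r0` by instantiating the discharged
PROVE binders with their landed theorems; see the module docstring. -/
theorem ufsc0_of_freeBoundaryHypothesis_r3 (hd : 3 ≤ d) {q : ℝ} {ε₀ : ℝ} (hq : 1 ≤ q) (hε₀ : 0 < ε₀)
    (p : unitInterval) (hp : (p : ℝ) ∈ Set.Ioo 0 1)
    (hFH : FH d q p) (h_tgt : KNFreeTargetHittable d q p) :
    ∃ r : ℕ, UFSC0 d q p r ε₀ :=
  haveI : NeZero d := ⟨by omega⟩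
  ufsc0_of_freeBoundaryHypothesis_r0 hd hq hε₀ p hp hFH h_tgt (knFreeElongatedHittable_of_one_le hq p)
    (knFreeCorridorRestr_of_one_le hq p) (knFreeOriginLook hq p) (knFreeBadRestr hq p)

end Summit.CriticalPhenomena.PercolationContinuityZ3.Theorems.FK
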